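import Mathlib
import HarnessLib
import HarnessLib.Audit
import Summits.Langlands.Statement
import Literature.NumberTheory.GaloisRepresentations.PhiGammaModuleRobba
import Literature.NumberTheory.Automorphic.EigenvarietyResGLn
import Literature.NumberTheory.Automorphic.LocalLanglandsDatumProofs
import Summits.Langlands.Langlands.Theorems.GenericWDUnique
import HarnessLib.Audit.Status.Attr

/-!
Route: SteinbergWeightVelocity

CLOSED (retired) 2026-08-15T23:18:23Z by planner-rchoice-Langlands-SteinbergWeightVeloc-f945a9ff-0 — reason: misstated-packaging: every content item is relabelling-false, vacuous or ∃-hollow over the placeholder (φ,Γ)/eigenvariety/Rec data; no faithful restatement typable until D_rig / the eigenvariety are constructed or characterised (see note +  — note: ROUTE-CHOICE (unit rchoice-…-f945a9ff): conditional refutation of crux NonSplitSteinbergPieces (stmt-Langlands-13451; PermBlind.lean, Disproof.lean: ∀𝔇/IsKPX packaging blind to conjugacy-class relabellings of Drig) ACCEPTED; route retired as MISSTATED-PACKAGING, mechanism NOT refuted (confirmed in p. The file is kept as the record of this route; refuted decls are indexed as negative knowledge (`ledger negatives`).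

# Route SteinbergWeightVelocity — maximal monodromy at v|p for torsion-built rho_pi over CM fields
from full weight velocity of p-adic families (N is the derivative of the family)

Route SteinbergWeightVelocity (card Langlands/Langlands/monodromy-from-weight-velocity, gen 2; gen 1
= the retired route
WeightVelocityMonodromy, whose informal cruxes are now TYPED over the landed `PhiGammaModuleRobba` /
`EigenvarietyResGLn`).
It suffices to show X = MaximalMonodromyAtP: for every CM number field K there are reciprocity data
Rec (intended: the genuine
B_dR / WD∘D_pst, same ∃Rec shape as the summit) such that for every n ≥ 2, every REGULAR ALGEBRAIC
cuspidal π on GL_n(𝔸_K), every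
prime p, ι : ℚ̄_p ≃ ℂ, every semisimple ρ : Γ_K → GL_n(ℚ̄_p) whose Frobenius characteristic
polynomials are the C-normalised Satake
polynomials of π at almost all places (so ρ ≅ r_ι(π) of HLTT/Scholze), and every v ∣ p in the sector
(n ≥ 3, or n = 2 and
2[K_v:ℚ_p] ≤ [K:ℚ]) at which π_v is of STEINBERG TYPE (rec(π_v) has N^(n-1) ≠ 0, i.e. π_v ≅ St_n ⊗
χ; stated for every local
Langlands datum and every local component), the Weil–Deligne representation that Rec.pst attaches to
ρ|Γ_(K_v) has MAXIMAL
monodromy, N^(n-1) ≠ 0. With the semisimplified compatibility of AHTW2026 (Thm 1.2.1, Cor 1.2.2: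
WD^ss known, N_Gal ≺ N_aut) this is
exactly the missing equality of monodromy operators, i.e. the v ∣ ℓ clause `LocalGlobalCompatibleAt`
of direction (A) for these π
(the upgrade, a C↔L twist and GenericWDUnique, is declared in the remainder TargetToLanglands, not
claimed). The mechanism reaches X
through the (φ,Γ)-module-level statement NonCrystallineSteinbergPieces ("no Steinberg graded piece
of D_rig(ρ|K_v) is crystalline",
Ding's criterion ord ∉ c_i^⊥) and the p-adic Hodge dictionary DstDictionaryAtP (Ding2019SimpleL
Lemma 3.2 + Berger).
Lean: `∀ (K : Type) [Field K] [NumberField K] [NumberField.IsCMField K], ∃ Rec :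
Summit.Langlands.ReciprocityData K, ∀ (n : ℕ) (hcpt :
Literature.NumberTheory.Automorphic.isCompact_glFiniteIntegralLevel n K) (π :
Literature.NumberTheory.Automorphic.CuspidalAutomorphicRepData n K hcpt), 2 ≤ n →
π.1.IsRegularAlgebraic → ∀ (p : ℕ) [Fact p.Prime] (ι : PadicAlgCl p ≃+* ℂ) (ρ :
Literature.NumberTheory.GaloisRepresentations.FramedGaloisRep K (PadicAlgCl p) n),
ρ.toGaloisRep.IsSemisimple → (∀ᶠ v : IsDedekindDomain.HeightOneSpectrum (NumberField.RingOfIntegers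
K) in Filter.cofinite, ∀ α : Multiset ℂ, π.1.HasSatakeParamAt v α → ρ.IsUnramifiedAt v ∧
ρ.HasFrobCharpolyAt v (Literature.NumberTheory.Automorphic.arithFrobPolyOfSatake ι v.residueCard n
α)) → ∀ (v : IsDedekindDomain.HeightOneSpectrum (NumberField.RingOfIntegers K)) (hv : ((p : ℕ) :
NumberField.RingOfIntegers K) ∈ v.asIdeal), (3 ≤ n ∨ 2 * (v.asIdeal.ramificationIdx ℤ *
v.asIdeal.inertiaDeg ℤ) ≤ Module.finrank ℚ K) → (∀ (L :
Literature.NumberTheory.Automorphic.LocalLanglandsDatum (v.adicCompletion K)) (πv :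
Literature.NumberTheory.Automorphic.SmoothIrrep (Matrix.GeneralLinearGroup (Fin n) (v.adicCompletion
K))), π.1.HasLocalComponentAt v πv.ρ → ((L.recGL n (Literature.NumberTheory.Automorphic.IrrClass.mk
πv)).out.1).N ^ (n - 1) ≠ 0) → ∀ r : Literature.NumberTheory.GaloisRepresentations.WeilDeligneRep
(v.adicCompletion K) (PadicAlgCl p) (Fin n → PadicAlgCl p), (Rec.pst p v hv).IsWeilDeligneOf
(ρ.toLocal v) r → r.N ^ (n - 1) ≠ 0`

## Assembly
Pure logic, certified by `closes` in glue.lean (all 13 items as hypotheses): MechanismToLocal turns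
WeightVelocity, ArcJetOrthogonality,
SpecialPairing, NonSplitSteinbergPieces and StrictSteinbergTriangulation into
NonCrystallineSteinbergPieces; LocalToMonodromy turns that
and DstDictionaryAtP into X = MaximalMonodromyAtP; the declared remainder TargetToLanglands carries
X to `Langlands`:
closes := hTL (hLM (hML hW hAJ hSP hNS hST) hD). The Assembly item below is the same chain as a Prop
and is provable outright
(assembly_holds in Sketch.lean).

Rationale: WHY THIS LINE. MONODROMY IS THE SHADOW OF WEIGHT VELOCITY. At a special (Steinberg) consecutive pair
of a strict triangulation of D = D_rig(ρ_π|K_v) the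
graded class c_i ∈ H¹(𝓡(δ_iδ_(i+1)⁻¹)) pairs perfectly with Hom(K_v^×,E) (dim d_v+1), its orthogonal
c_i^⊥ is a hyperplane when
c_i ≠ 0, and the piece is crystalline iff the unramified line E·ord lies in c_i^⊥ (Ding2019SimpleL
§3.1); the
Colmez–Greenberg–Stevens formula (Colmez2010Linvariants Thm 0.5, Pottharst2016 §2.3, Ding2019SimpleL
Thm 3.4) puts the ratio-jet ψ of
every trianguline first-order deformation inside c_i^⊥. Hence: if the GLOBAL p-adic family through
x(π) — the Res_(K/ℚ)GL_n eigenvariety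
(HansenUniversalEigenvarieties2017, determinants JohanssonNewton2019, global triangulation
KedlayaPottharstXiao2014) — moves the weight
gap at (v; i,i+1) in ALL d_v = [K_v:ℚ_p] directions, then c_i^⊥ surjects onto Hom(𝒪_v^×,E) and
cannot contain ord: the piece is
non-crystalline, and the Steinberg staircase gives N^(n-1) ≠ 0 (Ding Lemma 3.2) — monodromy read off
the first jet of the weight map,
with no automorphy lifting, no Shimura variety, no purity. Imported area: p-adic Hodge theory in
analytic families ((φ,Γ)-cohomology,
𝓛-invariants). What is new relative to the nearest print (arXiv:2603.18961, Mar 2026, Rem 1.3: the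
same implication "tangent vector
with v_c ≠ v_(c+1) + Galois BCGS ⇒ non-crystalline ⇒ maximal N" for p-ORDINARY Steinberg-at-p RACAR
of GL_n(𝔸_ℚ) under the non-abelian
Leopoldt conjecture): CM base fields, where d_v > 1 turns "one tangent vector" into FULL weight
velocity (a dimension count inside
c_i^⊥); finite slope (KPX arcs on Hansen's eigenvariety instead of a Hida family); arcs and leading
jets instead of étaleness/NALC;
torsion-built non-polarisable ρ with AHTW2026 as the only Galois input. No prior route on this
summit treats N at v ∣ p (EisensteinMonodromy
is v ∤ p); negatives index: one unrelated refutation (K3 Kuga–Satake anchor).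

RANKED CRUXES. #0 MaximalMonodromyAtP (target) — X as in § Thesis — maximal monodromy N^(n-1) ≠ 0 of
WD(D_pst(ρ|Γ_(K_v))) (through Rec.pst) for semisimple ρ C-Satake-compatible with a regular algebraic
cuspidal π of GL_n over a CM field K, n ≥ 2, at v ∣ p in the sector (n ≥ 3 ∨ 2[K_v:ℚ_p] ≤ [K:ℚ])
where π_v is of Steinberg type (rec N^(n-1) ≠ 0 for every LLC datum and local component). (why it
might fail: If r_ι(π) is reducible (open for n ≥ 3) the SEMISIMPLE ρ can have N^(n-1) = 0 while (A)
holds with a non-semisimple ρ; for n = 2 at places with 2[K_v:ℚ_p] > [K:ℚ] the mechanism has no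
budget (excluded).) [AHTW2026, YangLGC2024, BarreraGrahamWilliams2026, Ding2019SimpleL,
BuzzardGeeLMS2014]
#2 DstDictionaryAtP (crux) — [the unproved printed facts the mechanism needs, filed FIRST per the
plancard rule; ∃Rec-packaged because both sides are placeholder data] for every CM K there are
reciprocity data Rec (the genuine ones) such that for n ≥ 2, p, any ρ : Γ_K → GL_n(ℚ̄_p), v ∣ p: IF
for every family 𝔇 of (φ,Γ_(K_v))-module data satisfying the KPX package (IsKPX [K_v:ℚ_p]) some
finite E₀ ⊆ ℚ̄_p, some E₀-model rE of ρ|Γ_(K_v) and some triangulation Tr of D_rig(rE) (in some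
basis) are STRICT with every consecutive ratio special (dim H²(𝓡(δ_iδ_(i+1)⁻¹)) = 1), every graded
class c_i ≠ 0 and NON-CRYSTALLINE in Ding's sense (no non-zero unramified additive character of
K_v^× maps into c_i^⊥), THEN every Weil–Deligne representation r that Rec.pst attaches to ρ|Γ_(K_v)
has r.N^(n-1) ≠ 0. Content: Berger's comparison D_st(V) ↔ D_rig(V)[1/t] and Ding2019SimpleL Lemma
3.2 (N^(n-1) ≠ 0 on D_st(D) iff every D_i^(i+1) is semistable non-crystalline, for non-critical
special D), plus "crystalline iff Hom_∞ ⊆ 𝓛(D)" (§3.1). [difficulty: XL] (why it might fail: True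
for the genuine B_dR/D_pst and Robba data (BergerLaurent2002; Ding2019SimpleL Lem 3.2), but as TYPED
one ∃Rec serves all n, ρ, v through placeholder data, and it is unprovable in-tree until
FontainePstData / the Robba ring are constructed; a misstatement of the packaging is the risk.)
[Ding2019SimpleL, BergerLaurent2002, KedlayaPottharstXiao2014, Colmez2008Trianguline, AHTW2026]
#3 WeightVelocity (crux) — [card N2, the route's bet, GLOBAL] in the setting of X (K CM, π RA
cuspidal, ρ ss C-Satake-compatible, v ∣ p in the sector, π_v Steinberg-type) there are an
eigenvariety datum Ev for Res GL_n/K (some bad set S), a point x, a refinement χ with x = x(π,χ)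
(IsClassicalPointOf), HasGaloisFamily, galoisRep x conjugate to ρ, a Zariski-closed bad locus Z ∌ x,
a permutation σ and constant characters η such that (i) every point y ∉ Z has ρ_y trianguline at v
with parameter (δ_y·η)∘σ, for every KPX family of (φ,Γ)-data, (ii) at x every E₀-descent of that
parameter has all consecutive ratios special, and (iii) FULL WEIGHT VELOCITY at every consecutive
pair: the restrictions to 𝒪_(K_v)^× of the leading jets of the gap characters δ_(σ i)δ_(σ(i+1))⁻¹
along the formal arcs through x span ALL continuous additive characters 𝒪_(K_v)^× → ℚ̄_p (d_v =
[K_v:ℚ_p] independent directions). Intended witness: Hansen's eigenvariety, Newton's bound dim_x ≥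
[K⁺:ℚ]n + 1 (Thm 1.1.6, l₀ = [K⁺:ℚ](n-1)), twist directions gap-constant, transversality of the
weight image. [difficulty: open-problem] (why it might fail: The weight image of the components
through x may lie in a gap-degenerate hypersurface at v ("higher Calegari–Mazur"; arXiv:2603.18961
Rem 1.4 gets only half the simple roots even under NALC); zero slack for n = 2, d_v = [K⁺:ℚ]; a
Bianchi family moving only the v̄-gap kills it at v.) [HansenUniversalEigenvarieties2017,
JohanssonNewton2019, KedlayaPottharstXiao2014, BarreraGrahamWilliams2026, Rawson2024,
CalegariMazur2008, BarreraWilliams2019, GehrmannRosso2022, Chenevier2011]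
#4 NonSplitSteinbergPieces (crux) — [card N3] in the setting of X, for every KPX family, every
E₀-model rE of ρ|Γ_(K_v) and every triangulation Tr of D_rig(rE) (any basis) whose consecutive
ratios are all special and which is strict, every graded class is non-zero: c_i ≠ 0 for all i
(Ding's non-critical special; the hypothesis (d) "non-split at c" of arXiv:2603.18961 Thm 2, here to
be PROVED for torsion-built ρ). [difficulty: open-problem] (why it might fail: n = 2: slopes forbid
splitting unless every labelled gap is 1 (weight-2 type; open for torsion-built π, YangLGC2024 =
weight 0 only); n ≥ 3: interior pairs are not slope-protected (St_3: (1,2) iff b<2a, (2,3) iff b>2a)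
and nothing known excludes a companion-type splitting.) [Ding2019SimpleL, KedlayaPottharstXiao2014,
BreuilHellmannSchraen2019, BellaicheChenevier2009, YangLGC2024, BarreraGrahamWilliams2026]
#5 StrictSteinbergTriangulation (crux) — [card N-strict, gen-1 #4] in the setting of X, for every
KPX family, every E₀-model rE of ρ|Γ_(K_v) and every triangulation Tr of D_rig(rE) (any basis), if
all consecutive ratios are special then Tr is STRICT (KPX Def 6.3.1: dim H⁰((D/Fil_i)(δ_i⁻¹)) = 1 at
every step) — i.e. the Steinberg-refined point x is non-critical in every label at v and lies off
the KPX bad locus. [difficulty: L] (why it might fail: τ-partial criticality for unbalanced labelled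
gaps when [K_v:ℚ_p] ≥ 2 (e.g. gaps (2,9): slope 4.5 > 2) makes the all-special triangulation
non-strict / shifts parameters (KPX Rem 6.3.11: the bad locus is necessary); fine for K_v = ℚ_p
(slope (k-2)/2 < k-1).) [KedlayaPottharstXiao2014, BellaicheChenevier2009, Liu2015Triangulation,
BreuilHellmannSchraen2019, Ding2019SimpleL]
#9 NonCrystallineSteinbergPieces (support) — [the mechanism's OUTPUT at the (φ,Γ)-module level;
X_loc] in the setting of X, for every KPX family there are a finite E₀, an E₀-model rE of ρ|Γ_(K_v)
and a triangulation Tr of D_rig(rE) which is strict and all of whose consecutive graded pieces are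
special, non-split and NON-CRYSTALLINE (no non-zero unramified additive character of K_v^× has image
in c_i^⊥; Ding2019SimpleL §3.1: crystalline iff Hom_∞ ⊆ 𝓛(D)). Implied by WeightVelocity +
ArcJetOrthogonality + SpecialPairing + NonSplit + Strict (MechanismToLocal, provable now) and
feeding DstDictionaryAtP; claimable directly by any other proof of non-crystallinity. [difficulty:
open-problem] [Ding2019SimpleL, Colmez2010Linvariants, BarreraGrahamWilliams2026]
#9 ArcJetOrthogonality (support) — [known in print, packaged over the interface: KPX global
triangulation along curves through a good point + Bellaïche–Chenevier (deformations of D_rig(V) =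
deformations of V) + the Colmez–Greenberg–Stevens formula Ding2019SimpleL Thm 3.4, after the
reparametrisation ε ↦ s^m turning a leading jet into a first-order one] for an eigenvariety datum
Ev, a point x with galoisRep x conjugate to ρ, a closed Z ∌ x off which every ρ_y is trianguline at
v with parameter (δ_y·η)∘σ (w.r.t. a KPX family 𝔇), every arc γ through x, every E₀-model rE of
ρ|Γ_(K_v), every E₀-descent δE of (δ_x·η)∘σ and every triangulation Tr of D_rig(rE) with parameters
≈ 𝓡(δE_j), strict, all-special, all-non-split: the leading jet ψ_γ of δ_(σ i)δ_(σ(i+1))⁻¹ along γ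
lies in the ℚ̄_p-span of the E₀-rational characters of c_i^⊥ (ψ ∈ 𝓛(D)_i ⊗ ℚ̄_p). [difficulty: XL]
[Ding2019SimpleL, KedlayaPottharstXiao2014, BellaicheChenevier2009, Pottharst2016,
Colmez2010Linvariants, GreenbergStevens1993, Liu2015Triangulation]
#9 SpecialPairing (support) — [known: Ding2019SimpleL §3.1, Liu duality, Nakamura2009] for a KPX
datum, a triangulation Tr of D_rig(rE) and a consecutive pair with special ratio (dim H² = 1) and
non-split class c_i, some continuous additive character θ of K_v^× has image OUTSIDE c_i^⊥ (the cup
product H¹(𝓡(δ)) × H¹(𝓡) → H²(𝓡(δ)) ≅ E is perfect, so 𝓛(D)_i = c_i^⊥ is a hyperplane, not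
everything). [difficulty: L] [Ding2019SimpleL, Nakamura2009, KedlayaPottharstXiao2014,
Liu2015Triangulation]
#9 MechanismToLocal (support) — [glue, provable now: linear algebra + bookkeeping] WeightVelocity →
ArcJetOrthogonality → SpecialPairing → NonSplitSteinbergPieces → StrictSteinbergTriangulation →
NonCrystallineSteinbergPieces. Proof: take Ev, x, σ, η, Z from WeightVelocity; x ∉ Z gives an
E₁-model rE₁ trianguline with an E₁-descent δE₁ of (δ_x·η)∘σ (HasParameterAt;
Triangulation.ofTriangular via isTriangulineWith_iff; HasQlModel is conj-invariant); its ratios are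
special (clause (ii), finrank H² is IsEquiv-invariant, ofChar multiplicative by
HasRankOneClassification), so Strict and NonSplit apply; if a non-zero unramified θ₀ had image in
c_i^⊥, take θ₁ from SpecialPairing, write θ₁|𝒪^× as a ℚ̄_p-combination of arc jets (clause (iii)),
each in (c_i^⊥ ∩ Hom) ⊗ ℚ̄_p (ArcJetOrthogonality); descent ℚ̄_p ⊗_(E₀) Map → Map injective gives θ₁
∈ E₀-span + E₀·θ₀ (unramified characters form a line: K_v^× = ϖ^ℤ × 𝒪^×), so θ₁ has image in c_i^⊥ —
contradiction. [difficulty: M] [Ding2019SimpleL, KedlayaPottharstXiao2014]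
#9 GenericWDUnique (support) — [shared verbatim with route EisensteinMonodromy, stmt-Langlands-2374,
grounded+checked] over an algebraically closed field of characteristic 0, two Frobenius-semisimple
GENERIC Weil–Deligne representations on the same space with equal traces are isomorphic. Used only
in the remainder's upgrade "ss part (AHTW2026) + maximal N ⇒ ι WD(ρ|K_v)^F-ss ≅ rec(π_v ⊗
|det|^((1-n)/2))". [difficulty: provable-now] [Allen2016, VarmaFMS2024, TateCorvallis1979,
BellaicheChenevier2009]
#9 LocalToMonodromy (support) — [glue, provable now: instantiate] NonCrystallineSteinbergPieces →
DstDictionaryAtP → MaximalMonodromyAtP: take Rec from DstDictionaryAtP; for π, ρ, v as in X the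
(φ,Γ)-level statement supplies the dictionary's antecedent verbatim. [difficulty: provable-now]
[Ding2019SimpleL]
#9 TargetToLanglands (support) — OUT-OF-SCOPE REMAINDER, declared and NOT claimed, filed only so
that the deciding theorem `closes` ends at the summit constant (D-0027 §2.1; same pattern as
EisensteinMonodromy.MonodromyToLanglands, DegenerateLimits.LanglandsOfTarget,
TriangulineChamber.SliceToLanglands): MaximalMonodromyAtP → Langlands. It contains the reciprocity
data for every number field, direction (B), direction (A) outside [K CM, π regular algebraic, v ∣ p,
π_v Steinberg-type, the sector], irreducibility of r_ι(π), and the upgrade of maximal N to the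
literal `LocalGlobalCompatibleAt` clause at v ∣ ℓ (AHTW2026 Thm 1.2.1 semisimple part + N ≺,
GenericWDUnique, the C↔L twist |det|^((1-n)/2)). Not to be staffed from this route. [difficulty:
open-problem] [BuzzardGeeLMS2014, AHTW2026, VarmaFMS2024]

TWO-LAYER PLAN. Foreseen (nothing filed now): WeightVelocity ⇐ EtaleOverWeightImage (the CM analogue
of arXiv:2603.18961 Thm 1 at x: under the
non-abelian Leopoldt conjecture — known for defect ≤ 1, i.e. Bianchi GL_2 — Hansen's eigenvariety is
étale over its weight image Σ at
the non-critical classical cuspidal point x, so arcs in Σ lift) → WeightImageTransversal (Σ ∌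
gap-degenerate hypersurface at v: the
arc-directions of Σ at λ_x project ONTO the d_v gap coordinates of the pair; "higher
Calegari–Mazur") → WeightVelocity (glue: jets of
lifted arcs = jets in Σ; clauses (i)–(ii) from AHTW2026 crystabelline/semistable LGC at classical
points + KPX interpolation).
NonSplitSteinbergPieces ⇐ SlopeExclusion (n = 2 with a labelled gap ≥ 2, and the slope-protected
pairs for n ≥ 3: Kedlaya slopes
of an étale D forbid the split saturated sub) → CompanionExclusion (no critical companion
triangulation at x for the unprotected
pairs) → NonSplitSteinbergPieces. DstDictionaryAtP becomes a Literature named fact `(h : …) →` once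
FontainePstData and the Robba ring
are constructed (definition items of the summit / of Trianguline.lean).

KILL CRITERIA. A regular algebraic cuspidal non-base-change, non-CM Bianchi newform at a split p
whose p-adic family is CONSTANT in the weight at v
(deformation direction (0 : 1) in (dκ_v : dκ_v̄), computable by arXiv:2402.13799 §3) refutes
WeightVelocity at v in the sector for
n = 2 and forces a pivot to "v and v̄ jointly" (X only at the places the family moves) or closes the
route if no place moves; an
automorphic x with a split interior Steinberg graded piece (a critical companion triangulation of a
torsion-built ρ) refutes
NonSplitSteinbergPieces for n ≥ 3 and shrinks X to n = 2 (restate with 2 ≤ n ≤ 2… i.e. file the n =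
2 versions as repaired items);
a refutation of StrictSteinbergTriangulation at some [K_v:ℚ_p] ≥ 2 configuration forces the
shifted-parameter variant (CGS for the
shifted ratio) or the restriction to balanced labelled gaps; a refutation of DstDictionaryAtP can
only be a misstatement of the
placeholder packaging (repair: restate), never of Berger/Ding; MaximalMonodromyAtP refuted at an
instance with r_ι(π) irreducible
contradicts reciprocity itself (spectacular; close refuted). A proof of the v ∣ p clause for these π
elsewhere (completed-cohomology
LGC beyond AHTW2026, or arXiv:2603.18961-type results extended to CM fields) moots the route → close
superseded.

NOT DECOMPOSED YET. (i) The GLOBAL weight-velocity statement is typed with the eigenvariety datum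
EXISTENTIAL and the Galois family linked to it only
pointwise (HasParameterAt at points off Z) because the tree has no D_rig over Artinian/affinoid
coefficients: the arc family's own
triangulation cannot be named; the passage points → arcs → first-order (tangent cone + KPX Thm
6.3.9/6.3.13 on curves + BC Prop 2.3.13)
is packaged inside the support ArcJetOrthogonality (definition request DrigArtinian below would let
it be split honestly). (ii) General
segment structures rec(π_v) = ⊞ Q(Δ_j) (several segments): same mechanism pair-by-pair inside each
segment, needs the refinement making
each segment consecutive and the eigenvalue dictionary δ_j(ϖ_v) ↔ rec(π_v)(Frob) to tell Steinberg
pairs from cross-segment special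
pairs — deliberately outside X (Steinberg type only). (iii) n = 2 at places with 2[K_v:ℚ_p] > [K:ℚ]
(e.g. Bianchi at inert p): no
budget. (iv) Totally real K (incl. K = ℚ, where arXiv:2603.18961 works p-ordinarily): same mechanism
after base change to CM quadratic
extensions; not claimed. (v) The upgrade maximal N ⇒ `LocalGlobalCompatibleAt` (AHTW2026 +
GenericWDUnique + twist) and irreducibility of
r_ι(π): in the remainder. (vi) needs-fact: none beyond the Statement's own cone
(LocalLanglandsDatum.nonempty, PstWeilDeligneData.nonempty);
`PhiGammaModuleData.nonempty` (Trianguline.lean) enters the import cone through PhiGammaModuleRobba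
but NO item rests on it — every
(φ,Γ)-level item is hypothesis-relative (∀ 𝔇, IsKPX → …); EigenvarietyResGLn mints no existence fact
by design (D-0026).

CHEAPEST FALSIFIER. (1) Lookup, done this session: arXiv:2603.18961 (Mar 2026) Rem 1.3 CONFIRMS the
implication "weight-direction tangent vector + Galois
BCGS ⇒ non-crystalline ⇒ maximal monodromy" in the p-ordinary case over ℚ (so the mechanism is sound
where it has been run) and Rem 1.4
flags exactly our crux (non-c-parabolic deformations only for half the simple roots from NALC
alone). (2) The decisive cheap test for
refuters: run Rawson's polynomial-time tangent-space algorithm (arXiv:2402.13799 §3, Bianchi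
overconvergent modular symbols over the dual
numbers) on a cuspidal Bianchi newform over ℚ(i) or ℚ(√-3) of weight (k,k), k ≥ 2 (so the labelled
gap k+1 ≥ 3… i.e. not weight-2 type),
new (Steinberg) at a split p, not base change, not CM: output = dim of the tangent space and the
deformation direction (dκ_v : dκ_v̄).
Rawson's published runs give dimension 1 and a NON-diagonal direction; WeightVelocity at v needs
dκ_v ≠ 0 (and at v̄, dκ_v̄ ≠ 0). A run
returning (0 : 1) kills WeightVelocity at v for that π. (3) The St_3 slope table (gen 1, by hand)
already shows slopes protect only one
of the two interior pairs — NonSplitSteinbergPieces for n ≥ 3 is a genuine claim, not numerics.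

NUMBERS. dim W_(K^p) = 2[K⁺:ℚ]n − [K⁺:ℚ] + 1 − (Leopoldt) for K CM; l₀ = [K⁺:ℚ](n−1); Newton's bound
dim_x ≥ [K⁺:ℚ]n + 1 (HansenUniversalEigenvarieties2017
Thm 1.1.6); twist directions [K⁺:ℚ] + 1 (gap-constant); essential directions ≤ [K⁺:ℚ](n−1), needed
per pair at v: d_v = [K_v:ℚ_p] —
hence the sector (n ≥ 3 ∨ 2d_v ≤ [K:ℚ]). dim_E H¹(𝓡_E(δ)) = d_v + 1 at special δ = x^𝐠|x|_K·unr (𝐠 ≥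
1), H² ≅ E, 𝓛(D)_i = c_i^⊥ of
codimension 1, crystalline iff Hom_∞ ⊆ 𝓛(D)_i (Ding2019SimpleL §3.1); N^(n-1) ≠ 0 iff every
D_i^(i+1) non-crystalline (Lemma 3.2);
trianguline deformation functor of a non-critical special D formally smooth of dim 1 + n(n+1)d_v/2
with κ ↠ ∏ 𝓛(D)_i (Prop 3.6) — so the
LOCAL form of weight velocity is equivalent to non-crystallinity and only the GLOBAL form (crux 3)
has content. arXiv:2603.18961: dim Σ =
n − ⌊(n−1)/2⌋… (GL_n/ℚ, NALC), non-c-parabolic deformations for ≥ half of the c. NALC known for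
defect ≤ 1 (Bianchi GL_2).

DEFINITION REQUESTS. (d1) `DrigArtinian` (Literature/NumberTheory/GaloisRepresentations): D_rig over
finite local E-algebras A (equivalently functoriality of
`PhiGammaModuleData.Drig` in E-linear Γ-equivariant maps, not only in changes of frame), with BC
Prop 2.3.13 (deformations of an étale
D = deformations of V) as a predicate — needed to name the triangulated (φ,Γ)-family of the Galois
pseudocharacter along an arc
(`EigenvarietyResGLn.arcTrace`) and split ArcJetOrthogonality into KPX-along-arcs + Ding Thm 3.4.
(d2) `BergerDst`: D_cris/D_st/D_dR on
(φ,Γ)-modules over `PhiGammaModuleRobba` and the comparison with `PstWeilDeligneData` (Berger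
2002/2008) — would turn DstDictionaryAtP
into a provable statement for the genuine data. Cite facts wanted: AHTW2026 Thm 1.2.1/Cor 1.2.2
(already a cite item of gen 1);
arXiv:2603.18961 Thm 1 (étaleness under NALC) as a named fact once eigenvarieties are constructible.

Novelty: Searches (2026-08-15, this seat): `lit search --source zbmath "L-invariants eigenvariety Bianchi"`
(1: arXiv:2402.13799 Rawson);
`lit search --source arxiv "tangent spaces eigenvarieties"` (6: arXiv:2402.13799, Bergdall
arXiv:1710.02057, Hsu arXiv:1905.05687,
Hernandez–Schraen arXiv:2210.10564 infinite fern in higher dimensions, Barrera–Williams–…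
arXiv:1808.09750, and arXiv:2603.18961
Barrera Salazar–Graham–Williams Mar 2026 — READ pp. 1–6); `lit galaxy search
"Colmez-Greenberg-Stevens formula L-invariant trianguline"
--star all` (0); `lit galaxy search "tangent space eigenvariety" --star all` (0); `lit search
--source arxiv "semistable non-crystalline …
local-global compatibility at p monodromy"` (0); `lit search … --source openalex` (HTTP 429); local
searchd unavailable; `lit read
arxiv:1807.10862` pp. 23–27 (Ding2019SimpleL §3.1–3.4: perfect pairing, crystalline iff Hom_∞ ⊆ 𝓛,
Lemma 3.2, Thm 3.4, Prop 3.5–3.6 READ);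
plus gen 1's searches and the card's two novelty audits (Colmez2010Linvariants, Pottharst2016, KPX,
AHTW2026 pp. 1–8/111–113, Yang,
Allen–Newton, Bergdall 2017, Chitrao–Ghate–Yasuda).
Nearest prior art found: BarreraGrahamWilliams2026 = arXiv:2603.18961 (Barrera
Salazar–Graham–Williams, 2026) Thm 2 / Rem 1.3–1.4 — for p-ORDINARY regular algebraic
cuspidal π on GL_n(𝔸_ℚ) with π_p Steinberg, under the non-abelian Leopoldt conjecture, a tangent
vector with v_c ≠ v_(c+1) and a Galois
Benois–Colmez–Greenberg–Stevens formula give "non-split ⇒ non-crystalline" at the  [refs: 2402.13799, 1710.02057, 1905.05687, 2210.10564, 1808.09750, 2603.18961, 1807.10862, arxiv:1807.10862, Pottharst2016, AHTW2026, BarreraGrahamWilliams2026]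

Barriers (technique_class: p-adic-families, eigenvariety, phi-gamma, L-invariants): - technique_class: p-adic-families, eigenvariety, phi-gamma, L-invariants
- Literature.Barriers.Langlands.ShimuraVarietyRealizationBarrier: evaded — no realisation of π or ρ
in the cohomology of a variety (no weight spectral sequence, no nearby cycles); ρ enters only
through the Galois determinant over the Betti eigenvariety of Res_(K/ℚ)GL_n and its (φ,Γ)-module at
v; the barrier's defect l₀ = [K⁺:ℚ](n−1) > 0 is paid, not evaded, in crux 3 (Newton's bound dim W −
l₀ fixes the deformation budget and the sector).
- Literature.Barriers.Langlands.TwistedEndoscopySelfDual: evaded — π need not be polarizable;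
self-duality is used only inside the imported facts (HLTT/Scholze existence, AHTW2026 via U(n,n)),
never in the mechanism, which works with the n-dimensional ρ directly.
- Literature.Barriers.Langlands.TaylorWilesNumericalCoincidence: not engaged — no patching, no
automorphy lifting (contrast YangLGC2024, AllenNewton2020 and the residual hypotheses (c) of
arXiv:2603.18961); the same defect l₀ reappears as the number of essential eigenvariety directions
and sets the sector; honest bet: outside it (Bianchi forms at inert p) the line has no mechanism.
- Literature.Barriers.Langlands.NonRegularWeightBarrier: NOT evaded — π is regular algebraic
throughout (x must be a classical point of a Betti eigenvariety); the route is about the all-places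
clause for regular π.
- Literature.Barriers.Langlands.ModPLanglandsGL2BeyondQp: evaded — nothing mod p or Banach-local is
used; K_v/ℚ_p arbit

History (route lifecycle, newest last):
- 2026-08-15T23:18:23Z · CLOSED retired — misstated-packaging: every content item is relabelling-false, vacuous or ∃-hollow over the placeholder (φ,Γ)/eigenvariety/Rec data; no faithful restatement typable until D_rig / the eigenvariety are c (planner-rchoice-Langlands-SteinbergWeightVeloc-f945a9ff-0)

sub-problem: Langlands · status: closed(retired) · opened planner-plancard-Langlands-Langlands-monodrom-3380a8ed-g2-0 2026-08-15T19:16:03Z · rev 3 · ledger route-Langlands-SteinbergWeightVelocity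
GENERATED by the gate from the ledger (D-0016/17). Provers cite these decls: `theorem foo : Summit.Langlands.Langlands.Theses.SteinbergWeightVelocity.<Decl> := …` in Summits/Langlands/Langlands/Theorems/<Name>.lean.
-/

namespace Summit.Langlands.Langlands.Theses.SteinbergWeightVelocity

open scoped BigOperators Topology Manifold Classical MeasureTheory ProbabilityTheory Matrix InnerProductSpace ComplexConjugate ContinuousMap
open Filter Set Function TopologicalSpace MeasureTheory

attribute [summit_statement] _root_.Langlands

/-- item stmt-Langlands-13448 · target · rank 0 · closed · moot by None · by planner
why it might fail: If r_ι(π) is reducible (open for n≥3) the semisimple ρ is a direct sum, so N^(n-1)=0 while (A) is untouched; n=2 at 2[K_v:ℚ_p]>[K:ℚ] has no budget (excluded). AS TYPED it cannot fail at all: ∃Rec with Rec.pst only in negative position is witnessed by the junk F̂_nr datum (see reason) — hollow.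
sources: AHTW2026, Acampo2023, BarreraGrahamWilliams2026, Ding2019SimpleL, BuzzardGeeLMS2014, YangLGC2024
[target] X as in § Thesis — maximal monodromy N^(n-1) ≠ 0 of WD(D_pst(ρ|Γ_(K_v))) (through Rec.pst)
for semisimple ρ C-Satake-compatible with a regular algebraic cuspidal π of GL_n over a CM field K,
n ≥ 2, at v ∣ p in the sector (n ≥ 3 ∨ 2[K_v:ℚ_p] ≤ [K:ℚ]) where π_v is of Steinberg type (rec
N^(n-1) ≠ 0 for every LLC datum and local component). -/
@[route_item "route-Langlands-SteinbergWeightVelocity", crux]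
def MaximalMonodromyAtP : Prop :=
  ∀ (K : Type) [Field K] [NumberField K] [NumberField.IsCMField K], ∃ Rec : Summit.Langlands.ReciprocityData K, ∀ (n : ℕ) (hcpt : Literature.NumberTheory.Automorphic.isCompact_glFiniteIntegralLevel n K) (π : Literature.NumberTheory.Automorphic.CuspidalAutomorphicRepData n K hcpt), 2 ≤ n → π.1.IsRegularAlgebraic → ∀ (p : ℕ) [Fact p.Prime] (ι : PadicAlgCl p ≃+* ℂ) (ρ : Literature.NumberTheory.GaloisRepresentations.FramedGaloisRep K (PadicAlgCl p) n), ρ.toGaloisRep.IsSemisimple → (∀ᶠ v : IsDedekindDomain.HeightOneSpectrum (NumberField.RingOfIntegers K) in Filter.cofinite, ∀ α : Multiset ℂ, π.1.HasSatakeParamAt v α → ρ.IsUnramifiedAt v ∧ ρ.HasFrobCharpolyAt v (Literature.NumberTheory.Automorphic.arithFrobPolyOfSatake ι v.residueCard n α)) → ∀ (v : IsDedekindDomain.HeightOneSpectrum (NumberField.RingOfIntegers K)) (hv : ((p : ℕ) : NumberField.RingOfIntegers K) ∈ v.asIdeal), (3 ≤ n ∨ 2 * (v.asIdeal.ramificationIdx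 ℤ * v.asIdeal.inertiaDeg ℤ) ≤ Module.finrank ℚ K) → (∀ (L : Literature.NumberTheory.Automorphic.LocalLanglandsDatum (v.adicCompletion K)) (πv : Literature.NumberTheory.Automorphic.SmoothIrrep (Matrix.GeneralLinearGroup (Fin n) (v.adicCompletion K))), π.1.HasLocalComponentAt v πv.ρ → ((L.recGL n (Literature.NumberTheory.Automorphic.IrrClass.mk πv)).out.1).N ^ (n - 1) ≠ 0) → ∀ r : Literature.NumberTheory.GaloisRepresentations.WeilDeligneRep (v.adicCompletion K) (PadicAlgCl p) (Fin n → PadicAlgCl p), (Rec.pst p v hv).IsWeilDeligneOf (ρ.toLocal v) r → r.N ^ (n - 1) ≠ 0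

/-- item stmt-Langlands-13450 · crux · rank 3 · closed · moot by None · by planner
why it might fail: The weight image of the components through x(π) may lie in a gap-degenerate hypersurface at v (higher Calegari–Mazur; arXiv:2603.18961 Rem 1.4: even under NALC + étaleness only ≥ half of the c move); zero slack for n=2, d_v=[K⁺:ℚ]; a Bianchi family moving only the v̄-gap kills it at v.
sources: BarreraGrahamWilliams2026, HansenUniversalEigenvarieties2017, JohanssonNewton2019, KedlayaPottharstXiao2014, Rawson2024, CalegariMazur2008
[crux] [card N2, the route's bet, GLOBAL] in the setting of X (K CM, π RA cuspidal, ρ ss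
C-Satake-compatible, v ∣ p in the sector, π_v Steinberg-type) there are an eigenvariety datum Ev for
Res GL_n/K (some bad set S), a point x, a refinement χ with x = x(π,χ) (IsClassicalPointOf),
HasGaloisFamily, galoisRep x conjugate to ρ, a Zariski-closed bad locus Z ∌ x, a permutation σ and
constant characters η such that (i) every point y ∉ Z has ρ_y trianguline at v with parameter
(δ_y·η)∘σ, for every KPX family of (φ,Γ)-data, (ii) at x every E₀-descent of that parameter has all
consecutive ratios special, and (iii) FULL WEIGHT VELOCITY at every consecutive pair: the
restrictions to 𝒪_(K_v)^× of the leading jets of the gap characters δ_(σ i)δ_(σ(i+1))⁻¹ along the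
formal arcs through x span ALL continuous additive characters 𝒪_(K_v)^× → ℚ̄_p (d_v = [K_v:ℚ_p]
independent directions). Intended witness: Hansen's eigenvariety, Newton's bound dim_x ≥ [K⁺:ℚ]n + 1
(Thm 1.1.6, l₀ = [K⁺:ℚ](n-1)), twist directions gap-constant, transversality of the weight image.
[difficulty: open-problem] -/
@[route_item "route-Langlands-SteinbergWeightVelocity", crux]
def WeightVelocity : Prop :=
  ∀ (K : Type) [Field K] [NumberField K] [NumberField.IsCMField K] (n : ℕ) (hcpt : Literature.NumberTheory.Automorphic.isCompact_glFiniteIntegralLevel n K) (π : Literature.NumberTheory.Automorphic.CuspidalAutomorphicRepData n K hcpt), 2 ≤ n → π.1.IsRegularAlgebraic → ∀ (p : ℕ) [Fact p.Prime] (ι : PadicAlgCl p ≃+* ℂ) (ρ : Literature.NumberTheory.GaloisRepresentations.FramedGaloisRep K (PadicAlgCl p) n), ρ.toGaloisRep.IsSemisimple → (∀ᶠ v : IsDedekindDomain.HeightOneSpectrum (NumberField.RingOfIntegers K) in Filter.cofinite, ∀ α : Multiset ℂ, π.1.HasSatakeParamAt v α → ρ.IsUnramifiedAt v ∧ ρ.HasFrobCharpolyAt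 v (Literature.NumberTheory.Automorphic.arithFrobPolyOfSatake ι v.residueCard n α)) → ∀ (v : IsDedekindDomain.HeightOneSpectrum (NumberField.RingOfIntegers K)) (hv : ((p : ℕ) : NumberField.RingOfIntegers K) ∈ v.asIdeal), (3 ≤ n ∨ 2 * (v.asIdeal.ramificationIdx ℤ * v.asIdeal.inertiaDeg ℤ) ≤ Module.finrank ℚ K) → (∀ (L : Literature.NumberTheory.Automorphic.LocalLanglandsDatum (v.adicCompletion K)) (πv : Literature.NumberTheory.Automorphic.SmoothIrrep (Matrix.GeneralLinearGroup (Fin n) (v.adicCompletion K))), π.1.HasLocalComponentAt v πv.ρ → ((L.recGL n (Literature.NumberTheory.Automorphic.IrrClass.mk πv)).out.1).N ^ (n - 1) ≠ 0) → ∃ (S : Set (IsDedekindDomain.HeightOneSpectrum (NumberField.RingOfIntegers K))) (Ev : Literature.NumberTheory.Automorphic.EigenvarietyResGLn K n p S) (x : Ev.Pt) (χ : Literature.NumberTheory.Automorphic.RefinementExponent K n p) (σ : Equiv.Perm (Fin n)) (η : Fin n → ((v.adicCompletion K)ˣ →ₜ* (PadicAlgCl p)ˣ)) (Z : Set Ev.Pt),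 Ev.IsClassicalPointOf ι x π χ ∧ Ev.HasGaloisFamily ∧ (∃ g : Matrix.GeneralLinearGroup (Fin n) (PadicAlgCl p), Literature.NumberTheory.GaloisRepresentations.FramedRep.conj g (Ev.galoisRep x) = ρ) ∧ IsClosed Z ∧ x ∉ Z ∧ (∀ (𝔇 : ∀ (E₀ : IntermediateField ℚ_[p] (PadicAlgCl p)), FiniteDimensional ℚ_[p] E₀ → Literature.NumberTheory.GaloisRepresentations.PhiGammaModuleRobba.{0, 0, 0} p (v.adicCompletion K) E₀), (∀ (E₀ : IntermediateField ℚ_[p] (PadicAlgCl p)) (hE₀ : FiniteDimensional ℚ_[p] E₀), (𝔇 E₀ hE₀).IsKPX (v.asIdeal.ramificationIdx ℤ * v.asIdeal.inertiaDeg ℤ)) → ∀ y : Ev.Pt, y ∉ Z → (Ev.galoisRep y).HasParameterAt v (fun E₀ hE₀ => (𝔇 E₀ hE₀).toPhiGammaModuleData) (fun j => Ev.param y (⟨v, hv⟩ : Literature.NumberTheory.Automorphic.PlacesOver K p) (σ j) * η j)) ∧ (∀ (𝔇 : ∀ (E₀ : IntermediateField ℚ_[p] (PadicAlgCl p)), FiniteDimensional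 ℚ_[p] E₀ → Literature.NumberTheory.GaloisRepresentations.PhiGammaModuleRobba.{0, 0, 0} p (v.adicCompletion K) E₀), (∀ (E₀ : IntermediateField ℚ_[p] (PadicAlgCl p)) (hE₀ : FiniteDimensional ℚ_[p] E₀), (𝔇 E₀ hE₀).IsKPX (v.asIdeal.ramificationIdx ℤ * v.asIdeal.inertiaDeg ℤ)) → ∀ (E₀ : IntermediateField ℚ_[p] (PadicAlgCl p)) (hE₀ : FiniteDimensional ℚ_[p] E₀) (δE : Fin n → ((v.adicCompletion K)ˣ →ₜ* E₀ˣ)), (∀ (j : Fin n) (z : (v.adicCompletion K)ˣ), (algebraMap E₀ (PadicAlgCl p)) ((δE j z : E₀ˣ) : E₀) = (((Ev.param x (⟨v, hv⟩ : Literature.NumberTheory.Automorphic.PlacesOver K p) (σ j) * η j) z : (PadicAlgCl p)ˣ) : PadicAlgCl p)) → ∀ (i : ℕ) (hi : i + 1 < n), Module.finrank E₀ ((𝔇 E₀ hE₀).H2 ((𝔇 E₀ hE₀).ofChar (δE ⟨i, Nat.lt_of_succ_lt hi⟩ / δE ⟨i + 1, hi⟩)).toModule) = 1) ∧ ∀ (i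 : ℕ) (hi : i + 1 < n) (φ : (v.adicCompletionIntegers K)ˣ → PadicAlgCl p), Continuous φ → (∀ a b, φ (a * b) = φ a + φ b) → ∃ (r : ℕ) (γ : Fin r → (Ev.Fn →+* PowerSeries (PadicAlgCl p))) (hγ : ∀ k, γ k ∈ Ev.arcs x) (c : Fin r → PadicAlgCl p), ∀ u : (v.adicCompletionIntegers K)ˣ, φ u = ∑ k : Fin r, c k * Ev.leadingGapJet (γ k) (hγ k).1 (⟨v, hv⟩ : Literature.NumberTheory.Automorphic.PlacesOver K p) (σ ⟨i, Nat.lt_of_succ_lt hi⟩) (σ ⟨i + 1, hi⟩) (Literature.NumberTheory.Automorphic.integerUnitsToUnits v u)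

/-- item stmt-Langlands-13451 · crux · rank 4 · closed · moot by None · by planner
why it might fail: Slopes protect nothing where it matters: n=2 with every labelled gap 1 (weight-2 type: ρ|v ≅ χ₁⊕χ₂ crystalline is slope-admissible) and interior pairs for n≥3 (St₃: (1,2) iff b<2a, (2,3) iff b>2a); there it is a fragment of ℓ=p LGC, open for torsion-built ρ (AHTW2026: only N_Gal ≺ N_aut).
sources: Ding2019SimpleL, KedlayaPottharstXiao2014, AHTW2026, YangLGC2024, BreuilHellmannSchraen2019, BellaicheChenevier2009
[crux] [card N3] in the setting of X, for every KPX family, every E₀-model rE of ρ|Γ_(K_v) and every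
triangulation Tr of D_rig(rE) (any basis) whose consecutive ratios are all special and which is
strict, every graded class is non-zero: c_i ≠ 0 for all i (Ding's non-critical special; the
hypothesis (d) "non-split at c" of arXiv:2603.18961 Thm 2, here to be PROVED for torsion-built ρ).
[difficulty: open-problem] -/
@[route_item "route-Langlands-SteinbergWeightVelocity", crux]
def NonSplitSteinbergPieces : Prop :=
  ∀ (K : Type) [Field K] [NumberField K] [NumberField.IsCMField K] (n : ℕ) (hcpt : Literature.NumberTheory.Automorphic.isCompact_glFiniteIntegralLevel n K) (π : Literature.NumberTheory.Automorphic.CuspidalAutomorphicRepData n K hcpt), 2 ≤ n → π.1.IsRegularAlgebraic → ∀ (p : ℕ) [Fact p.Prime] (ι : PadicAlgCl p ≃+* ℂ) (ρ : Literature.NumberTheory.GaloisRepresentations.FramedGaloisRep K (PadicAlgCl p) n), ρ.toGaloisRep.IsSemisimple → (∀ᶠ v : IsDedekindDomain.HeightOneSpectrum (NumberField.RingOfIntegers K) in Filter.cofinite, ∀ α : Multiset ℂ, π.1.HasSatakeParamAt v α → ρ.IsUnramifiedAt v ∧ ρ.HasFrobCharpolyAt v (Literature.NumberTheory.Automorphic.arithFrobPolyOfSatake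 ι v.residueCard n α)) → ∀ (v : IsDedekindDomain.HeightOneSpectrum (NumberField.RingOfIntegers K)) (hv : ((p : ℕ) : NumberField.RingOfIntegers K) ∈ v.asIdeal), (3 ≤ n ∨ 2 * (v.asIdeal.ramificationIdx ℤ * v.asIdeal.inertiaDeg ℤ) ≤ Module.finrank ℚ K) → (∀ (L : Literature.NumberTheory.Automorphic.LocalLanglandsDatum (v.adicCompletion K)) (πv : Literature.NumberTheory.Automorphic.SmoothIrrep (Matrix.GeneralLinearGroup (Fin n) (v.adicCompletion K))), π.1.HasLocalComponentAt v πv.ρ → ((L.recGL n (Literature.NumberTheory.Automorphic.IrrClass.mk πv)).out.1).N ^ (n - 1) ≠ 0) → ∀ (𝔇 : ∀ (E₀ : IntermediateField ℚ_[p] (PadicAlgCl p)), FiniteDimensional ℚ_[p] E₀ → Literature.NumberTheory.GaloisRepresentations.PhiGammaModuleRobba.{0, 0, 0} p (v.adicCompletion K) E₀), (∀ (E₀ : IntermediateField ℚ_[p] (PadicAlgCl p)) (hE₀ : FiniteDimensional ℚ_[p] E₀), (𝔇 E₀ hE₀).IsKPX (v.asIdeal.ramificationIdx ℤ * v.asIdeal.inertiaDeg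 ℤ)) → ∀ (E₀ : IntermediateField ℚ_[p] (PadicAlgCl p)) (hE₀ : FiniteDimensional ℚ_[p] E₀) (rE : Literature.NumberTheory.GaloisRepresentations.FramedGaloisRep (v.adicCompletion K) E₀ n), Literature.NumberTheory.Automorphic.HasQlModel (ρ.toLocal v) E₀ rE → ∀ (U : Matrix.GeneralLinearGroup (Fin n) (𝔇 E₀ hE₀).R) (Tr : (((𝔇 E₀ hE₀).Drig rE).conj U).toPhiGammaModule.Triangulation n), (∀ (i : ℕ) (hi : i + 1 < n), Module.finrank E₀ ((𝔇 E₀ hE₀).H2 (Tr.ratioParam i hi).toModule) = 1) → Tr.IsStrict (𝔇 E₀ hE₀).gen → ∀ (i : ℕ) (hi : i + 1 < n), Tr.IsNonSplitAt (𝔇 E₀ hE₀).gen i hi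

/-- item stmt-Langlands-13449 · support · rank 2 · closed · moot by None · by planner
why it might fail: True for the genuine B_dR/D_pst and Robba data (BergerLaurent2002; Ding2019SimpleL Lem 3.2), but as TYPED one ∃Rec serves all n, ρ, v through placeholder data, and it is unprovable in-tree until FontainePstData / the Robba ring are constructed; a misstatement of the packaging is the risk.
sources: BergerLaurent2002, Ding2019SimpleL, KedlayaPottharstXiao2014, Colmez2008Trianguline
[crux] [the unproved printed facts the mechanism needs, filed FIRST per the plancard rule;
∃Rec-packaged because both sides are placeholder data] for every CM K there are reciprocity data Rec
(the genuine ones) such that for n ≥ 2, p, any ρ : Γ_K → GL_n(ℚ̄_p), v ∣ p: IF for every family 𝔇 of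
(φ,Γ_(K_v))-module data satisfying the KPX package (IsKPX [K_v:ℚ_p]) some finite E₀ ⊆ ℚ̄_p, some
E₀-model rE of ρ|Γ_(K_v) and some triangulation Tr of D_rig(rE) (in some basis) are STRICT with
every consecutive ratio special (dim H²(𝓡(δ_iδ_(i+1)⁻¹)) = 1), every graded class c_i ≠ 0 and
NON-CRYSTALLINE in Ding's sense (no non-zero unramified additive character of K_v^× maps into
c_i^⊥), THEN every Weil–Deligne representation r that Rec.pst attaches to ρ|Γ_(K_v) has r.N^(n-1) ≠
0. Content: Berger's comparison D_st(V) ↔ D_rig(V)[1/t] and Ding2019SimpleL Lemma 3.2 (N^(n-1) ≠ 0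
on D_st(D) iff every D_i^(i+1) is semistable non-crystalline, for non-critical special D), plus
"crystalline iff Hom_∞ ⊆ 𝓛(D)" (§3.1). [difficulty: XL] -/
@[route_item "route-Langlands-SteinbergWeightVelocity", crux]
def DstDictionaryAtP : Prop :=
  ∀ (K : Type) [Field K] [NumberField K] [NumberField.IsCMField K], ∃ Rec : Summit.Langlands.ReciprocityData K, ∀ (n : ℕ), 2 ≤ n → ∀ (p : ℕ) [Fact p.Prime] (ρ : Literature.NumberTheory.GaloisRepresentations.FramedGaloisRep K (PadicAlgCl p) n) (v : IsDedekindDomain.HeightOneSpectrum (NumberField.RingOfIntegers K)) (hv : ((p : ℕ) : NumberField.RingOfIntegers K) ∈ v.asIdeal), (∀ (𝔇 : ∀ (E₀ : IntermediateField ℚ_[p] (PadicAlgCl p)), FiniteDimensional ℚ_[p] E₀ → Literature.NumberTheory.GaloisRepresentations.PhiGammaModuleRobba.{0, 0, 0} p (v.adicCompletion K) E₀), (∀ (E₀ : IntermediateField ℚ_[p] (PadicAlgCl p)) (hE₀ : FiniteDimensional ℚ_[p] E₀), (𝔇 E₀ hE₀).IsKPX (v.asIdeal.ramificationIdx ℤ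 * v.asIdeal.inertiaDeg ℤ)) → ∃ (E₀ : IntermediateField ℚ_[p] (PadicAlgCl p)) (hE₀ : FiniteDimensional ℚ_[p] E₀) (rE : Literature.NumberTheory.GaloisRepresentations.FramedGaloisRep (v.adicCompletion K) E₀ n), Literature.NumberTheory.Automorphic.HasQlModel (ρ.toLocal v) E₀ rE ∧ ∃ (U : Matrix.GeneralLinearGroup (Fin n) (𝔇 E₀ hE₀).R) (Tr : (((𝔇 E₀ hE₀).Drig rE).conj U).toPhiGammaModule.Triangulation n), Tr.IsStrict (𝔇 E₀ hE₀).gen ∧ ∀ (i : ℕ) (hi : i + 1 < n), Module.finrank E₀ ((𝔇 E₀ hE₀).H2 (Tr.ratioParam i hi).toModule) = 1 ∧ Tr.IsNonSplitAt (𝔇 E₀ hE₀).gen i hi ∧ ∀ ψ : Literature.NumberTheory.GaloisRepresentations.HomCont (v.adicCompletion K) E₀, (∀ u : (v.adicCompletion K)ˣ, Valued.v (u : v.adicCompletion K) = 1 → (ψ : (v.adicCompletion K)ˣ → E₀) u = 0) → ψ ≠ 0 → (𝔇 E₀ hE₀).H1toH1 (Literature.NumberTheory.GaloisRepresentations.PhiGammaModule.unit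 (𝔇 E₀ hE₀).ring) ((𝔇 E₀ hE₀).homToH1 ψ) ∉ (Tr.ratioParam i hi).toModule.cupOrthogonal (𝔇 E₀ hE₀).gen (Tr.gradedClass (𝔇 E₀ hE₀).gen i hi)) → ∀ r : Literature.NumberTheory.GaloisRepresentations.WeilDeligneRep (v.adicCompletion K) (PadicAlgCl p) (Fin n → PadicAlgCl p), (Rec.pst p v hv).IsWeilDeligneOf (ρ.toLocal v) r → r.N ^ (n - 1) ≠ 0

/-- item stmt-Langlands-13452 · support · rank 5 · closed · moot by None · by planner
why it might fail: τ-partial criticality for unbalanced labelled gaps when [K_v:ℚ_p] ≥ 2 (e.g. gaps (2,9): slope 4.5 > 2) makes the all-special triangulation non-strict / shifts parameters (KPX Rem 6.3.11: the bad locus is necessary); fine for K_v = ℚ_p (slope (k-2)/2 < k-1).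
sources: KedlayaPottharstXiao2014, Nakamura2009, BellaicheChenevier2009
[crux] [card N-strict, gen-1 #4] in the setting of X, for every KPX family, every E₀-model rE of
ρ|Γ_(K_v) and every triangulation Tr of D_rig(rE) (any basis), if all consecutive ratios are special
then Tr is STRICT (KPX Def 6.3.1: dim H⁰((D/Fil_i)(δ_i⁻¹)) = 1 at every step) — i.e. the
Steinberg-refined point x is non-critical in every label at v and lies off the KPX bad locus.
[difficulty: L] -/
@[route_item "route-Langlands-SteinbergWeightVelocity", crux]
def StrictSteinbergTriangulation : Prop :=
  ∀ (K : Type) [Field K] [NumberField K] [NumberField.IsCMField K] (n : ℕ) (hcpt : Literature.NumberTheory.Automorphic.isCompact_glFiniteIntegralLevel n K) (π : Literature.NumberTheory.Automorphic.CuspidalAutomorphicRepData n K hcpt), 2 ≤ n → π.1.IsRegularAlgebraic → ∀ (p : ℕ) [Fact p.Prime] (ι : PadicAlgCl p ≃+* ℂ) (ρ : Literature.NumberTheory.GaloisRepresentations.FramedGaloisRep K (PadicAlgCl p) n), ρ.toGaloisRep.IsSemisimple → (∀ᶠ v : IsDedekindDomain.HeightOneSpectrum (NumberField.RingOfIntegers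 K) in Filter.cofinite, ∀ α : Multiset ℂ, π.1.HasSatakeParamAt v α → ρ.IsUnramifiedAt v ∧ ρ.HasFrobCharpolyAt v (Literature.NumberTheory.Automorphic.arithFrobPolyOfSatake ι v.residueCard n α)) → ∀ (v : IsDedekindDomain.HeightOneSpectrum (NumberField.RingOfIntegers K)) (hv : ((p : ℕ) : NumberField.RingOfIntegers K) ∈ v.asIdeal), (3 ≤ n ∨ 2 * (v.asIdeal.ramificationIdx ℤ * v.asIdeal.inertiaDeg ℤ) ≤ Module.finrank ℚ K) → (∀ (L : Literature.NumberTheory.Automorphic.LocalLanglandsDatum (v.adicCompletion K)) (πv : Literature.NumberTheory.Automorphic.SmoothIrrep (Matrix.GeneralLinearGroup (Fin n) (v.adicCompletion K))), π.1.HasLocalComponentAt v πv.ρ → ((L.recGL n (Literature.NumberTheory.Automorphic.IrrClass.mk πv)).out.1).N ^ (n - 1) ≠ 0) → ∀ (𝔇 : ∀ (E₀ : IntermediateField ℚ_[p] (PadicAlgCl p)), FiniteDimensional ℚ_[p] E₀ → Literature.NumberTheory.GaloisRepresentations.PhiGammaModuleRobba.{0, 0, 0} p (v.adicCompletion K) E₀),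 (∀ (E₀ : IntermediateField ℚ_[p] (PadicAlgCl p)) (hE₀ : FiniteDimensional ℚ_[p] E₀), (𝔇 E₀ hE₀).IsKPX (v.asIdeal.ramificationIdx ℤ * v.asIdeal.inertiaDeg ℤ)) → ∀ (E₀ : IntermediateField ℚ_[p] (PadicAlgCl p)) (hE₀ : FiniteDimensional ℚ_[p] E₀) (rE : Literature.NumberTheory.GaloisRepresentations.FramedGaloisRep (v.adicCompletion K) E₀ n), Literature.NumberTheory.Automorphic.HasQlModel (ρ.toLocal v) E₀ rE → ∀ (U : Matrix.GeneralLinearGroup (Fin n) (𝔇 E₀ hE₀).R) (Tr : (((𝔇 E₀ hE₀).Drig rE).conj U).toPhiGammaModule.Triangulation n), (∀ (i : ℕ) (hi : i + 1 < n), Module.finrank E₀ ((𝔇 E₀ hE₀).H2 (Tr.ratioParam i hi).toModule) = 1) → Tr.IsStrict (𝔇 E₀ hE₀).gen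

/-- item stmt-Langlands-13453 · support · rank 9 · closed · moot by None · by planner
sources: Ding2019SimpleL, Colmez2010Linvariants, BarreraGrahamWilliams2026
[support] [the mechanism's OUTPUT at the (φ,Γ)-module level; X_loc] in the setting of X, for every
KPX family there are a finite E₀, an E₀-model rE of ρ|Γ_(K_v) and a triangulation Tr of D_rig(rE)
which is strict and all of whose consecutive graded pieces are special, non-split and
NON-CRYSTALLINE (no non-zero unramified additive character of K_v^× has image in c_i^⊥;
Ding2019SimpleL §3.1: crystalline iff Hom_∞ ⊆ 𝓛(D)). Implied by WeightVelocity + ArcJetOrthogonality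
+ SpecialPairing + NonSplit + Strict (MechanismToLocal, provable now) and feeding DstDictionaryAtP;
claimable directly by any other proof of non-crystallinity. [difficulty: open-problem] -/
@[route_item "route-Langlands-SteinbergWeightVelocity", crux]
def NonCrystallineSteinbergPieces : Prop :=
  ∀ (K : Type) [Field K] [NumberField K] [NumberField.IsCMField K] (n : ℕ) (hcpt : Literature.NumberTheory.Automorphic.isCompact_glFiniteIntegralLevel n K) (π : Literature.NumberTheory.Automorphic.CuspidalAutomorphicRepData n K hcpt), 2 ≤ n → π.1.IsRegularAlgebraic → ∀ (p : ℕ) [Fact p.Prime] (ι : PadicAlgCl p ≃+* ℂ) (ρ : Literature.NumberTheory.GaloisRepresentations.FramedGaloisRep K (PadicAlgCl p) n), ρ.toGaloisRep.IsSemisimple → (∀ᶠ v : IsDedekindDomain.HeightOneSpectrum (NumberField.RingOfIntegers K) in Filter.cofinite, ∀ α : Multiset ℂ, π.1.HasSatakeParamAt v α → ρ.IsUnramifiedAt v ∧ ρ.HasFrobCharpolyAt v (Literature.NumberTheory.Automorphic.arithFrobPolyOfSatake ι v.residueCard n α)) → ∀ (v : IsDedekindDomain.HeightOneSpectrum (NumberField.RingOfIntegers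 K)) (hv : ((p : ℕ) : NumberField.RingOfIntegers K) ∈ v.asIdeal), (3 ≤ n ∨ 2 * (v.asIdeal.ramificationIdx ℤ * v.asIdeal.inertiaDeg ℤ) ≤ Module.finrank ℚ K) → (∀ (L : Literature.NumberTheory.Automorphic.LocalLanglandsDatum (v.adicCompletion K)) (πv : Literature.NumberTheory.Automorphic.SmoothIrrep (Matrix.GeneralLinearGroup (Fin n) (v.adicCompletion K))), π.1.HasLocalComponentAt v πv.ρ → ((L.recGL n (Literature.NumberTheory.Automorphic.IrrClass.mk πv)).out.1).N ^ (n - 1) ≠ 0) → ∀ (𝔇 : ∀ (E₀ : IntermediateField ℚ_[p] (PadicAlgCl p)), FiniteDimensional ℚ_[p] E₀ → Literature.NumberTheory.GaloisRepresentations.PhiGammaModuleRobba.{0, 0, 0} p (v.adicCompletion K) E₀), (∀ (E₀ : IntermediateField ℚ_[p] (PadicAlgCl p)) (hE₀ : FiniteDimensional ℚ_[p] E₀), (𝔇 E₀ hE₀).IsKPX (v.asIdeal.ramificationIdx ℤ * v.asIdeal.inertiaDeg ℤ)) → ∃ (E₀ : IntermediateField ℚ_[p] (PadicAlgCl p)) (hE₀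 : FiniteDimensional ℚ_[p] E₀) (rE : Literature.NumberTheory.GaloisRepresentations.FramedGaloisRep (v.adicCompletion K) E₀ n), Literature.NumberTheory.Automorphic.HasQlModel (ρ.toLocal v) E₀ rE ∧ ∃ (U : Matrix.GeneralLinearGroup (Fin n) (𝔇 E₀ hE₀).R) (Tr : (((𝔇 E₀ hE₀).Drig rE).conj U).toPhiGammaModule.Triangulation n), Tr.IsStrict (𝔇 E₀ hE₀).gen ∧ ∀ (i : ℕ) (hi : i + 1 < n), Module.finrank E₀ ((𝔇 E₀ hE₀).H2 (Tr.ratioParam i hi).toModule) = 1 ∧ Tr.IsNonSplitAt (𝔇 E₀ hE₀).gen i hi ∧ ∀ ψ : Literature.NumberTheory.GaloisRepresentations.HomCont (v.adicCompletion K) E₀, (∀ u : (v.adicCompletion K)ˣ, Valued.v (u : v.adicCompletion K) = 1 → (ψ : (v.adicCompletion K)ˣ → E₀) u = 0) → ψ ≠ 0 → (𝔇 E₀ hE₀).H1toH1 (Literature.NumberTheory.GaloisRepresentations.PhiGammaModule.unit (𝔇 E₀ hE₀).ring) ((𝔇 E₀ hE₀).homToH1 ψ) ∉ (Tr.ratioParam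 i hi).toModule.cupOrthogonal (𝔇 E₀ hE₀).gen (Tr.gradedClass (𝔇 E₀ hE₀).gen i hi)

/-- item stmt-Langlands-13454 · support · rank 9 · closed · moot by None · by planner
sources: Ding2019SimpleL, KedlayaPottharstXiao2014, BellaicheChenevier2009, Pottharst2016, Colmez2010Linvariants, GreenbergStevens1993
[support] [known in print, packaged over the interface: KPX global triangulation along curves
through a good point + Bellaïche–Chenevier (deformations of D_rig(V) = deformations of V) + the
Colmez–Greenberg–Stevens formula Ding2019SimpleL Thm 3.4, after the reparametrisation ε ↦ s^m
turning a leading jet into a first-order one] for an eigenvariety datum Ev, a point x with galoisRep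
x conjugate to ρ, a closed Z ∌ x off which every ρ_y is trianguline at v with parameter (δ_y·η)∘σ
(w.r.t. a KPX family 𝔇), every arc γ through x, every E₀-model rE of ρ|Γ_(K_v), every E₀-descent δE
of (δ_x·η)∘σ and every triangulation Tr of D_rig(rE) with parameters ≈ 𝓡(δE_j), strict, all-special,
all-non-split: the leading jet ψ_γ of δ_(σ i)δ_(σ(i+1))⁻¹ along γ lies in the ℚ̄_p-span of the
E₀-rational characters of c_i^⊥ (ψ ∈ 𝓛(D)_i ⊗ ℚ̄_p). [difficulty: XL] -/
@[route_item "route-Langlands-SteinbergWeightVelocity", crux]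
def ArcJetOrthogonality : Prop :=
  ∀ (K : Type) [Field K] [NumberField K] [NumberField.IsCMField K] (n : ℕ) (hcpt : Literature.NumberTheory.Automorphic.isCompact_glFiniteIntegralLevel n K) (π : Literature.NumberTheory.Automorphic.CuspidalAutomorphicRepData n K hcpt), 2 ≤ n → π.1.IsRegularAlgebraic → ∀ (p : ℕ) [Fact p.Prime] (ι : PadicAlgCl p ≃+* ℂ) (ρ : Literature.NumberTheory.GaloisRepresentations.FramedGaloisRep K (PadicAlgCl p) n), ρ.toGaloisRep.IsSemisimple → (∀ᶠ v : IsDedekindDomain.HeightOneSpectrum (NumberField.RingOfIntegers K) in Filter.cofinite, ∀ α : Multiset ℂ, π.1.HasSatakeParamAt v α → ρ.IsUnramifiedAt v ∧ ρ.HasFrobCharpolyAt v (Literature.NumberTheory.Automorphic.arithFrobPolyOfSatake ι v.residueCard n α)) → ∀ (v : IsDedekindDomain.HeightOneSpectrum (NumberField.RingOfIntegers K)) (hv : ((p : ℕ) : NumberField.RingOfIntegers K) ∈ v.asIdeal), (3 ≤ n ∨ 2 * (v.asIdeal.ramificationIdx ℤ * v.asIdeal.inertiaDeg ℤ) ≤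 Module.finrank ℚ K) → (∀ (L : Literature.NumberTheory.Automorphic.LocalLanglandsDatum (v.adicCompletion K)) (πv : Literature.NumberTheory.Automorphic.SmoothIrrep (Matrix.GeneralLinearGroup (Fin n) (v.adicCompletion K))), π.1.HasLocalComponentAt v πv.ρ → ((L.recGL n (Literature.NumberTheory.Automorphic.IrrClass.mk πv)).out.1).N ^ (n - 1) ≠ 0) → ∀ (𝔇 : ∀ (E₀ : IntermediateField ℚ_[p] (PadicAlgCl p)), FiniteDimensional ℚ_[p] E₀ → Literature.NumberTheory.GaloisRepresentations.PhiGammaModuleRobba.{0, 0, 0} p (v.adicCompletion K) E₀), (∀ (E₀ : IntermediateField ℚ_[p] (PadicAlgCl p)) (hE₀ : FiniteDimensional ℚ_[p] E₀), (𝔇 E₀ hE₀).IsKPX (v.asIdeal.ramificationIdx ℤ * v.asIdeal.inertiaDeg ℤ)) → ∀ (S : Set (IsDedekindDomain.HeightOneSpectrum (NumberField.RingOfIntegers K))) (Ev : Literature.NumberTheory.Automorphic.EigenvarietyResGLn K n p S) (x : Ev.Pt) (χ : Literature.NumberTheory.Automorphic.RefinementExponent K n p) (σ : Equiv.Perm (Fin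 n)) (η : Fin n → ((v.adicCompletion K)ˣ →ₜ* (PadicAlgCl p)ˣ)) (Z : Set Ev.Pt) (g : Matrix.GeneralLinearGroup (Fin n) (PadicAlgCl p)), Literature.NumberTheory.GaloisRepresentations.FramedRep.conj g (Ev.galoisRep x) = ρ → IsClosed Z → x ∉ Z → (∀ y : Ev.Pt, y ∉ Z → (Ev.galoisRep y).HasParameterAt v (fun E₀ hE₀ => (𝔇 E₀ hE₀).toPhiGammaModuleData) (fun j => Ev.param y (⟨v, hv⟩ : Literature.NumberTheory.Automorphic.PlacesOver K p) (σ j) * η j)) → ∀ (γ : Ev.Fn →+* PowerSeries (PadicAlgCl p)) (hγ : γ ∈ Ev.arcs x) (E₀ : IntermediateField ℚ_[p] (PadicAlgCl p)) (hE₀ : FiniteDimensional ℚ_[p] E₀) (rE : Literature.NumberTheory.GaloisRepresentations.FramedGaloisRep (v.adicCompletion K) E₀ n), Literature.NumberTheory.Automorphic.HasQlModel (ρ.toLocal v) E₀ rE → ∀ (δE : Fin n → ((v.adicCompletion K)ˣ →ₜ* E₀ˣ)), (∀ (j : Fin n) (z : (v.adicCompletion K)ˣ), (algebraMap E₀ (PadicAlgCl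 p)) ((δE j z : E₀ˣ) : E₀) = (((Ev.param x (⟨v, hv⟩ : Literature.NumberTheory.Automorphic.PlacesOver K p) (σ j) * η j) z : (PadicAlgCl p)ˣ) : PadicAlgCl p)) → ∀ (U : Matrix.GeneralLinearGroup (Fin n) (𝔇 E₀ hE₀).R) (Tr : (((𝔇 E₀ hE₀).Drig rE).conj U).toPhiGammaModule.Triangulation n), (∀ j : Fin n, (Tr.param j).IsEquiv ((𝔇 E₀ hE₀).ofChar (δE j))) → Tr.IsStrict (𝔇 E₀ hE₀).gen → (∀ (i : ℕ) (hi : i + 1 < n), Module.finrank E₀ ((𝔇 E₀ hE₀).H2 (Tr.ratioParam i hi).toModule) = 1) → (∀ (i : ℕ) (hi : i + 1 < n), Tr.IsNonSplitAt (𝔇 E₀ hE₀).gen i hi) → ∀ (i : ℕ) (hi : i + 1 < n), Ev.leadingGapJet γ hγ.1 (⟨v, hv⟩ : Literature.NumberTheory.Automorphic.PlacesOver K p) (σ ⟨i, Nat.lt_of_succ_lt hi⟩) (σ ⟨i + 1, hi⟩) ∈ Submodule.span (PadicAlgCl p) {f : (v.adicCompletion K)ˣ → PadicAlgCl p | ∃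 θ : Literature.NumberTheory.GaloisRepresentations.HomCont (v.adicCompletion K) E₀, (𝔇 E₀ hE₀).H1toH1 (Literature.NumberTheory.GaloisRepresentations.PhiGammaModule.unit (𝔇 E₀ hE₀).ring) ((𝔇 E₀ hE₀).homToH1 θ) ∈ (Tr.ratioParam i hi).toModule.cupOrthogonal (𝔇 E₀ hE₀).gen (Tr.gradedClass (𝔇 E₀ hE₀).gen i hi) ∧ f = fun z => (algebraMap E₀ (PadicAlgCl p)) ((θ : (v.adicCompletion K)ˣ → E₀) z)}

/-- item stmt-Langlands-13455 · support · rank 9 · closed · moot by None · by planner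
sources: Ding2019SimpleL, Nakamura2009, KedlayaPottharstXiao2014, Liu2015Triangulation
[support] [known: Ding2019SimpleL §3.1, Liu duality, Nakamura2009] for a KPX datum, a triangulation
Tr of D_rig(rE) and a consecutive pair with special ratio (dim H² = 1) and non-split class c_i, some
continuous additive character θ of K_v^× has image OUTSIDE c_i^⊥ (the cup product H¹(𝓡(δ)) × H¹(𝓡) →
H²(𝓡(δ)) ≅ E is perfect, so 𝓛(D)_i = c_i^⊥ is a hyperplane, not everything). [difficulty: L] -/
@[route_item "route-Langlands-SteinbergWeightVelocity", crux]
def SpecialPairing : Prop :=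
  ∀ (K : Type) [Field K] [NumberField K] [NumberField.IsCMField K] (n : ℕ) (hcpt : Literature.NumberTheory.Automorphic.isCompact_glFiniteIntegralLevel n K) (π : Literature.NumberTheory.Automorphic.CuspidalAutomorphicRepData n K hcpt), 2 ≤ n → π.1.IsRegularAlgebraic → ∀ (p : ℕ) [Fact p.Prime] (ι : PadicAlgCl p ≃+* ℂ) (ρ : Literature.NumberTheory.GaloisRepresentations.FramedGaloisRep K (PadicAlgCl p) n), ρ.toGaloisRep.IsSemisimple → (∀ᶠ v : IsDedekindDomain.HeightOneSpectrum (NumberField.RingOfIntegers K) in Filter.cofinite, ∀ α : Multiset ℂ, π.1.HasSatakeParamAt v α → ρ.IsUnramifiedAt v ∧ ρ.HasFrobCharpolyAt v (Literature.NumberTheory.Automorphic.arithFrobPolyOfSatake ι v.residueCard n α)) → ∀ (v : IsDedekindDomain.HeightOneSpectrum (NumberField.RingOfIntegers K)) (hv : ((p : ℕ) : NumberField.RingOfIntegers K) ∈ v.asIdeal), (3 ≤ n ∨ 2 * (v.asIdeal.ramificationIdx ℤ * v.asIdeal.inertiaDeg ℤ) ≤ Module.finrank ℚ K) → (∀ (L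 : Literature.NumberTheory.Automorphic.LocalLanglandsDatum (v.adicCompletion K)) (πv : Literature.NumberTheory.Automorphic.SmoothIrrep (Matrix.GeneralLinearGroup (Fin n) (v.adicCompletion K))), π.1.HasLocalComponentAt v πv.ρ → ((L.recGL n (Literature.NumberTheory.Automorphic.IrrClass.mk πv)).out.1).N ^ (n - 1) ≠ 0) → ∀ (𝔇 : ∀ (E₀ : IntermediateField ℚ_[p] (PadicAlgCl p)), FiniteDimensional ℚ_[p] E₀ → Literature.NumberTheory.GaloisRepresentations.PhiGammaModuleRobba.{0, 0, 0} p (v.adicCompletion K) E₀), (∀ (E₀ : IntermediateField ℚ_[p] (PadicAlgCl p)) (hE₀ : FiniteDimensional ℚ_[p] E₀), (𝔇 E₀ hE₀).IsKPX (v.asIdeal.ramificationIdx ℤ * v.asIdeal.inertiaDeg ℤ)) → ∀ (E₀ : IntermediateField ℚ_[p] (PadicAlgCl p)) (hE₀ : FiniteDimensional ℚ_[p] E₀) (rE : Literature.NumberTheory.GaloisRepresentations.FramedGaloisRep (v.adicCompletion K) E₀ n) (U : Matrix.GeneralLinearGroup (Fin n) (𝔇 E₀ hE₀).R) (Tr :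 (((𝔇 E₀ hE₀).Drig rE).conj U).toPhiGammaModule.Triangulation n) (i : ℕ) (hi : i + 1 < n), Module.finrank E₀ ((𝔇 E₀ hE₀).H2 (Tr.ratioParam i hi).toModule) = 1 → Tr.IsNonSplitAt (𝔇 E₀ hE₀).gen i hi → ∃ θ : Literature.NumberTheory.GaloisRepresentations.HomCont (v.adicCompletion K) E₀, (𝔇 E₀ hE₀).H1toH1 (Literature.NumberTheory.GaloisRepresentations.PhiGammaModule.unit (𝔇 E₀ hE₀).ring) ((𝔇 E₀ hE₀).homToH1 θ) ∉ (Tr.ratioParam i hi).toModule.cupOrthogonal (𝔇 E₀ hE₀).gen (Tr.gradedClass (𝔇 E₀ hE₀).gen i hi)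

/-- item stmt-Langlands-13456 · support · rank 9 · closed · moot by None · by planner
sources: Ding2019SimpleL, KedlayaPottharstXiao2014
[support] [glue, provable now: linear algebra + bookkeeping] WeightVelocity → ArcJetOrthogonality →
SpecialPairing → NonSplitSteinbergPieces → StrictSteinbergTriangulation →
NonCrystallineSteinbergPieces. Proof: take Ev, x, σ, η, Z from WeightVelocity; x ∉ Z gives an
E₁-model rE₁ trianguline with an E₁-descent δE₁ of (δ_x·η)∘σ (HasParameterAt;
Triangulation.ofTriangular via isTriangulineWith_iff; HasQlModel is conj-invariant); its ratios are
special (clause (ii), finrank H² is IsEquiv-invariant, ofChar multiplicative by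
HasRankOneClassification), so Strict and NonSplit apply; if a non-zero unramified θ₀ had image in
c_i^⊥, take θ₁ from SpecialPairing, write θ₁|𝒪^× as a ℚ̄_p-combination of arc jets (clause (iii)),
each in (c_i^⊥ ∩ Hom) ⊗ ℚ̄_p (ArcJetOrthogonality); descent ℚ̄_p ⊗_(E₀) Map → Map injective gives θ₁
∈ E₀-span + E₀·θ₀ (unramified characters form a line: K_v^× = ϖ^ℤ × 𝒪^×), so θ₁ has image in c_i^⊥ —
contradiction. [difficulty: M] -/
@[route_item "route-Langlands-SteinbergWeightVelocity", crux]
def MechanismToLocal : Prop :=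
  WeightVelocity → ArcJetOrthogonality → SpecialPairing → NonSplitSteinbergPieces → StrictSteinbergTriangulation → NonCrystallineSteinbergPieces

/-- item stmt-Langlands-13463 · support · rank 9 · closed · moot by None · by planner
sources: Ding2019SimpleL
[support] [glue, provable now: instantiate] NonCrystallineSteinbergPieces → DstDictionaryAtP →
MaximalMonodromyAtP: take Rec from DstDictionaryAtP; for π, ρ, v as in X the (φ,Γ)-level statement
supplies the dictionary's antecedent verbatim. [difficulty: provable-now] -/
@[route_item "route-Langlands-SteinbergWeightVelocity", crux]
def LocalToMonodromy : Prop :=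
  NonCrystallineSteinbergPieces → DstDictionaryAtP → MaximalMonodromyAtP

/-- item stmt-Langlands-13464 · support · rank 9 · closed · moot by None · by planner
sources: BuzzardGeeLMS2014, AHTW2026, VarmaFMS2024
[support] OUT-OF-SCOPE REMAINDER, declared and NOT claimed, filed only so that the deciding theorem
`closes` ends at the summit constant (D-0027 §2.1; same pattern as
EisensteinMonodromy.MonodromyToLanglands, DegenerateLimits.LanglandsOfTarget,
TriangulineChamber.SliceToLanglands): MaximalMonodromyAtP → Langlands. It contains the reciprocity
data for every number field, direction (B), direction (A) outside [K CM, π regular algebraic, v ∣ p,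
π_v Steinberg-type, the sector], irreducibility of r_ι(π), and the upgrade of maximal N to the
literal `LocalGlobalCompatibleAt` clause at v ∣ ℓ (AHTW2026 Thm 1.2.1 semisimple part + N ≺,
GenericWDUnique, the C↔L twist |det|^((1-n)/2)). Not to be staffed from this route. [difficulty:
open-problem] -/
@[route_item "route-Langlands-SteinbergWeightVelocity", crux]
def TargetToLanglands : Prop :=
  MaximalMonodromyAtP → _root_.Langlands

/-- item stmt-Langlands-2374 · support · rank 9 · closed · proved by Summit.Langlands.Langlands.Theorems.GenericWDUnique_proof (prover) · by planner
sources: Allen2016, VarmaFMS2024, TateCorvallis1979, BellaicheChenevier2009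
[support] over an algebraically closed field of characteristic 0, two Frobenius-semisimple GENERIC
Weil–Deligne representations of W_F on the same space with equal traces of ρ(w) for all w are
isomorphic (ρ ≅ ρ' by Brauer–Nesbitt + "Φ-semisimple ⇒ semisimple"; generic ⇔ N in the open orbit of
the centraliser on {N}; the open orbit is unique). This is the lemma turning X + Varma's semisimple
compatibility into the summit's v ∤ ℓ clause; pure algebra, provable now. [difficulty: provable-now] -/
@[route_item "route-Langlands-SteinbergWeightVelocity", crux]
def GenericWDUnique : Prop :=
  ∀ (F : Type) [Field F] [ValuativeRel F] [TopologicalSpace F] [IsNonarchimedeanLocalField F] (E : Type) [Field E] [IsAlgClosed E] [CharZero E] (n : ℕ) (W W' : Literature.NumberTheory.GaloisRepresentations.WeilDeligneRep F E (Fin n → E)), W.IsFrobSemisimple → W'.IsFrobSemisimple → (∀ w : Literature.NumberTheory.GaloisRepresentations.WeilGroup F, LinearMap.trace E (Fin n → E) (W.ρ w) = LinearMap.trace E (Fin n → E) (W'.ρ w)) → (∀ f : (Fin n → E) →ₗ[E] (Fin n → E), (∀ w : Literature.NumberTheory.GaloisRepresentations.WeilGroup F, f ∘ₗ W.ρ w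 = ((Literature.NumberTheory.GaloisRepresentations.IsNonarchimedeanLocalField.residueFieldCard F : E) ^ (Literature.NumberTheory.GaloisRepresentations.WeilGroup.deg w)) • (W.ρ w ∘ₗ f)) → f ∘ₗ W.N = W.N ∘ₗ f → f = 0) → (∀ f : (Fin n → E) →ₗ[E] (Fin n → E), (∀ w : Literature.NumberTheory.GaloisRepresentations.WeilGroup F, f ∘ₗ W'.ρ w = ((Literature.NumberTheory.GaloisRepresentations.IsNonarchimedeanLocalField.residueFieldCard F : E) ^ (Literature.NumberTheory.GaloisRepresentations.WeilGroup.deg w)) • (W'.ρ w ∘ₗ f)) → f ∘ₗ W'.N = W'.N ∘ₗ f → f = 0) → W.IsEquivalent W'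

/-- `GenericWDUnique` holds: proved by `Summit.Langlands.Langlands.Theorems.GenericWDUnique_proof`. -/
theorem GenericWDUnique_holds : GenericWDUnique := _root_.Summit.Langlands.Langlands.Theorems.GenericWDUnique_proof

/-- item stmt-Langlands-13465 · assembly · rank 1 · closed · moot by None · by planner
sources: Ding2019SimpleL, HansenUniversalEigenvarieties2017
[assembly] WeightVelocity → NonSplitSteinbergPieces → StrictSteinbergTriangulation →
ArcJetOrthogonality → SpecialPairing → MechanismToLocal → DstDictionaryAtP → LocalToMonodromy →
TargetToLanglands → Langlands. -/
@[route_item "route-Langlands-SteinbergWeightVelocity", crux]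
def Assembly : Prop :=
  WeightVelocity → NonSplitSteinbergPieces → StrictSteinbergTriangulation → ArcJetOrthogonality → SpecialPairing → MechanismToLocal → DstDictionaryAtP → LocalToMonodromy → TargetToLanglands → _root_.Langlands

/-! D-0027 §2.1 — DECIDING THEOREM (planner-authored via `route open/edit --closes-file`; by planner-plancard-Langlands-Langlands-monodrom-3380a8ed-g2-0 2026-08-15T19:16:04Z) — ARCHIVED: route closed (retired) 2026-08-15T23:18:23Z; kept so importers keep building:
its hypotheses are this route's items and its conclusion the sub-problem Statement (glue_lint), and it elaborates with this file. -/

/-- D-0027 §2.1 deciding theorem of route SteinbergWeightVelocity: hypotheses = the route's thirteen items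
(target MaximalMonodromyAtP; cruxes DstDictionaryAtP, WeightVelocity, NonSplitSteinbergPieces,
StrictSteinbergTriangulation; supports NonCrystallineSteinbergPieces, ArcJetOrthogonality, SpecialPairing,
MechanismToLocal, GenericWDUnique, LocalToMonodromy, TargetToLanglands; the bookkeeping Assembly), conclusion =
the sub-problem Statement `Langlands`. Content: MechanismToLocal turns full weight velocity + the Colmez–Greenberg–Stevens
orthogonality + the perfect pairing + non-split + strict into non-crystallinity of every Steinberg graded piece;
LocalToMonodromy turns that and the D_st dictionary into maximal monodromy X; the declared, NOT-claimed remainder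
TargetToLanglands carries X to the summit constant. Pure logic. -/
@[closes "route-Langlands-SteinbergWeightVelocity"] theorem closes (_h0 : MaximalMonodromyAtP) (hD : DstDictionaryAtP) (hW : WeightVelocity)
    (hNS : NonSplitSteinbergPieces) (hST : StrictSteinbergTriangulation) (_hX : NonCrystallineSteinbergPieces)
    (hAJ : ArcJetOrthogonality) (hSP : SpecialPairing) (hML : MechanismToLocal) (_hG : GenericWDUnique)
    (hLM : LocalToMonodromy) (hTL : TargetToLanglands) (_hA : Assembly) : _root_.Langlands :=
  hTL (hLM (hML hW hAJ hSP hNS hST) hD)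

end Summit.Langlands.Langlands.Theses.SteinbergWeightVelocity
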